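import Literature.AlgebraicGeometry.AbelianVarieties.LineBundleTensorPower
import Literature.AlgebraicGeometry.Modules.DetClassOfIso
import Literature.AlgebraicGeometry.Modules.UnitCocyclePresented
import Literature.AlgebraicGeometry.Motives.AbelianVarietyFrobeniusTwistVariety
import HarnessLib

/-!
# Frobenius acts on `Pic` by the `q`-th power: `F^*[L] = [L]^q` in `Ȟ¹(X, 𝒪_X^×)`, `F^*L ≅ L^{⊗q}`,
# and the relative form `F_{A/k}^*(L^{(q)}) ≅ L^{⊗q}` (Hartshorne IV §2 Rem. 2.4.1 ∕ Ex. 2.4; Mumford AV §15)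

Layers `Literature/AlgebraicGeometry/Modules` (§1–§3, any scheme) and `…/Motives` (§4, abelian varieties);
namespaces `Literature.AlgebraicGeometry.Modules` and `Literature.AlgebraicGeometry.Motives.AbelianVariety`.
KERNEL FILE: theorems + ONE plumbing definition (`UnitCocycle.npow`, the `n`-th power of a cocycle on its own
cover); no named fact, no instance, no notation, no `sorry`.  Cell `hodgecm-mathlib`, programme P6 (MOD), the
GEOMETRIC CORE of the A-lane organ (DF) «`(F_A)^∨ = V_{A^∨}`, i.e. `F^*λ^{(q)} = q·λ`» named in desk F0P6d-plan's
ST1-CUT v1 §1 and in desk F0P6a-plan's HEART-FROB v1 §B (1) («uses `F_A^∨ λ^{(q)} F_A = qλ`»).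

## Mathematics

Let `X` be a scheme and `F = powEndo X n : X → X` the tree's power endomorphism (the identity on the topological
space, `s ↦ sⁿ` on `𝒪_X`, defined whenever `s ↦ sⁿ` is additive on all rings of sections — the absolute Frobenius
`absoluteFrobenius X p` and its powers `absFrobeniusOver p m X` (`n = p^m`) on a scheme of characteristic `p`, the
`k`-linear `q`-Frobenius `frobeniusOver X` of a scheme over `𝔽_q`).  Since `F` is the identity on opens and the
`n`-th power on sections, it pulls a Čech `1`-cocycle `(U_x, g_{xy})` of units back to `(U_x, g_{xy}ⁿ)`
(§2 `UnitCocycle.pullback_powEndo_equiv_npow`), so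

  **`F^* = (·)ⁿ` on `Ȟ¹(X, 𝒪_X^×)`**   (`CechPic.pullback_powEndo`),

and therefore, `Pic X ↪ Ȟ¹(X, 𝒪_X^×)` being injective on line bundles (★ `nonempty_iso_iff_detClass_eq`) and
compatible with pull-back (★ `detClass_pullback`) and tensor powers (★ `detClass_tensorPow`),

  **`F^*L ≅ L^{⊗n}`** for every finite locally free rank-one `𝒪_X`-module `L`   (`nonempty_pullback_powEndo_iso_tensorPow`)

— Hartshorne IV §2 (Rem. 2.4.1, Ex. 2.4): «the Frobenius pulls `𝒪(D)` back to `𝒪(D)^{⊗p}`», here for modules (the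
divisor twin is ★ `CartierDivisorFrobeniusPullback`).  If `F = G ≫ π` factors (§3), then `G^*(π^*L) ≅ L^{⊗n}`; for an
abelian variety `A` over a field `k` of exponential characteristic `p`, the relative Frobenius
`F_{A/k} : A → A^{(q)}` (`q = p^m`) followed by the projection `pr : A^{(q)} → A` IS the absolute `q`-Frobenius
(★ `toSchemeHom_relFrobenius_comp_twistFst`), whence (§4)

  **`F_{A/k}^*(pr^*L) ≅ L^{⊗q}`**   (`AbelianVariety.nonempty_pullback_relFrobenius_twist_iso_tensorPow`),

i.e. the relative Frobenius pulls the Frobenius twist `L^{(q)} = pr^*L` of a line bundle back to `L^{⊗q}`.  Applied to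
the Poincaré bundle of `A × Â` this is the fibrewise input of «`F_{Â} ≫ (F_A)^∨ = [q]`», hence of
`(F_A)^∨ = V_{Â}` and `F^*λ^{(q)} = q·λ` ([MumfordAV1970] §15; [Oda1969] §1), by the method of ★ (SYM-n)
`PoincareSheafMulN` ∕ ★ `DualIsogenyMulN`.

## Contents
* §1 `UnitCocycle.npow` and `CechPic.mk_npow` (`[(U, gⁿ)] = [(U, g)]ⁿ`);
* §2 `UnitCocycle.pullback_powEndo_equiv_npow`, **`CechPic.pullback_powEndo`**, `CechPic.pullback_absoluteFrobenius`,
  `CechPic.pullback_absFrobeniusOver`, `CechPic.pullback_frobeniusOver_left`;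
* §3 **`nonempty_pullback_powEndo_iso_tensorPow`**, `nonempty_pullback_comp_iso_tensorPow_of_comp_eq_powEndo`
  (`G ≫ π = F ⟹ G^*(π^*L) ≅ L^{⊗n}`), `nonempty_pullback_absFrobeniusOver_iso_tensorPow`;
* §4 **`AbelianVariety.nonempty_pullback_relFrobenius_twist_iso_tensorPow`**.

HC_CM is proved only modulo the printed citations until rung 0 closes; this file changes no count.

## References
* [Hartshorne1977] R. Hartshorne, *Algebraic Geometry* (1977), IV §2 Rem. 2.4.1 and Ex. 2.4 (Frobenius, `X_p`,
  `F'^*`), II Ex. 6.8 ∕ 6.11, III Ex. 4.5 (`Pic X ≅ Ȟ¹(X, 𝒪_X^×)`).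
* [MumfordAV1970] D. Mumford, *Abelian Varieties* (1970), §15 Thm. 1 p. 143 (duality of Frobenius-type isogenies via
  the Poincaré bundle), §8 (iv) p. 75.
* [Oda1969] T. Oda, *The first de Rham cohomology group and Dieudonné modules*, Ann. Sci. ÉNS (4) 2 (1969), §1
  (Cor. 1.3: `F` and `V` are adjoint under the Weil pairing).
-/

noncomputable section

universe u

open CategoryTheory CategoryTheory.Limits AlgebraicGeometry Opposite

-- `Scheme.Modules` / `SheafOfModules` are not reducible (as in Mathlib's `AlgebraicGeometry/Modules/Sheaf.lean`).
set_option backward.isDefEq.respectTransparency false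

namespace Literature.AlgebraicGeometry.Modules

open Literature.AlgebraicGeometry.Motives Literature.AlgebraicGeometry.AbelianVarieties

variable {X : Scheme.{u}}

/-! ## §1 Powers of cocycles -/

namespace UnitCocycle

/-- The `n`-th power of a cocycle on its own cover: `(U_x, g_{xy}) ↦ (U_x, g_{xy}ⁿ)`. [cite: Hartshorne1977, III Ex. 4.5] -/
def npow (c : UnitCocycle X) (n : ℕ) : UnitCocycle X where
  U := c.U
  mem := c.mem
  g x y V hx hy := c.g x y V hx hy ^ n
  map_g x y V V' hx hy i := by rw [map_pow, c.map_g]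
  g_mul x y z V hx hy hz := by rw [← mul_pow, c.g_mul]
  g_self x V hx := by rw [c.g_self, one_pow]

/-- The transition functions of `c.npow n` are the `n`-th powers of those of `c`. [cite: Hartshorne1977, III Ex. 4.5] -/
theorem npow_g (c : UnitCocycle X) (n : ℕ) (x y : X) (V : X.Opens) (hx : V ≤ c.U x) (hy : V ≤ c.U y) :
    (c.npow n).g x y V hx hy = c.g x y V hx hy ^ n := rfl

end UnitCocycle

namespace CechPic

/-- **`[(U, gⁿ)] = [(U, g)]ⁿ`** in `Ȟ¹(X, 𝒪_X^×)`. [cite: Hartshorne1977, III Ex. 4.5] -/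
theorem mk_npow (c : UnitCocycle X) : ∀ n : ℕ, mk (c.npow n) = mk c ^ n
  | 0 => by
    rw [pow_zero, ← mk_one]
    refine sound (UnitCocycle.equiv_of_eq _ _ c.U c.mem (fun _ => le_rfl) (fun _ => le_top) ?_)
    intro x y V hx hy
    exact (pow_zero _).symm
  | n + 1 => by
    rw [pow_succ, ← mk_npow c n, ← mk_mul]
    refine sound (UnitCocycle.equiv_of_eq _ _ c.U c.mem (fun _ => le_rfl) (fun _ => le_inf le_rfl le_rfl) ?_)
    intro x y V hx hy
    exact (pow_succ _ _).symm

end CechPic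

/-! ## §2 `F^* = (·)ⁿ` on `Ȟ¹(X, 𝒪_X^×)` for the power endomorphism `F` -/

section PowEndo

variable (X) (n : ℕ) (hn : n ≠ 0) (hadd : ∀ (U : X.Opens) (a b : Γ(X, U)), (a + b) ^ n = a ^ n + b ^ n)

/-- The power endomorphism `F` (identity on opens, `s ↦ sⁿ` on sections) pulls a cocycle `(U, g)` back to a cocycle
cohomologous (indeed equal) to `(U, gⁿ)`. [cite: Hartshorne1977, IV §2 Rem. 2.4.1] -/
theorem UnitCocycle.pullback_powEndo_equiv_npow (c : UnitCocycle X) :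
    UnitCocycle.Equiv (UnitCocycle.pullback (powEndo X n hn hadd) c) (c.npow n) := by
  refine UnitCocycle.equiv_of_eq _ _ c.U c.mem (fun _ => le_rfl) (fun _ => le_rfl) ?_
  intro x y V hx hy
  change c.g x y V hx hy ^ n =
    ((powEndo X n hn hadd).app (c.U x ⊓ c.U y) ≫ X.presheaf.map (homOfLE _).op) (c.g x y _ inf_le_left inf_le_right)
  rw [CommRingCat.comp_apply, powEndo_app_apply, map_pow]
  change _ = secRes X (le_inf hx hy : V ≤ c.U x ⊓ c.U y) (c.g x y _ inf_le_left inf_le_right) ^ n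
  rw [c.map_g]

/-- **Frobenius acts on `Ȟ¹(X, 𝒪_X^×)` by the `n`-th power**: `F^* x = xⁿ` for the power endomorphism
`F = powEndo X n` (identity on the space, `s ↦ sⁿ` on `𝒪_X`). [cite: Hartshorne1977, IV §2 Rem. 2.4.1 and Ex. 2.4] -/
theorem CechPic.pullback_powEndo (x : CechPic X) : CechPic.pullback (powEndo X n hn hadd) x = x ^ n := by
  obtain ⟨c, rfl⟩ := CechPic.mk_surjective x
  rw [CechPic.pullback_mk, ← CechPic.mk_npow]
  exact CechPic.sound (UnitCocycle.pullback_powEndo_equiv_npow X n hn hadd c)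

/-- The absolute Frobenius of a scheme of characteristic `p` acts on `Ȟ¹(X, 𝒪_X^×)` by the `p`-th power.
[cite: Hartshorne1977, IV §2 Rem. 2.4.1 and Ex. 2.4] -/
theorem CechPic.pullback_absoluteFrobenius (p : ℕ) [Fact p.Prime] (hp : (p : Γ(X, ⊤)) = 0) (x : CechPic X) :
    CechPic.pullback (absoluteFrobenius X p hp) x = x ^ p :=
  CechPic.pullback_powEndo X p _ _ x

end PowEndo

section OverField

variable {k : Type u} [Field k]

/-- The absolute `q`-Frobenius (`q = p^m`) of a scheme over a field of exponential characteristic `p` acts on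
`Ȟ¹(X, 𝒪_X^×)` by the `q`-th power. [cite: Hartshorne1977, IV §2 Rem. 2.4.1 and Ex. 2.4] -/
theorem CechPic.pullback_absFrobeniusOver (p : ℕ) [ExpChar k p] (m : ℕ) (X : SchemeOver k) (x : CechPic X.left) :
    CechPic.pullback (absFrobeniusOver p m X) x = x ^ p ^ m :=
  CechPic.pullback_powEndo X.left (p ^ m) _ _ x

/-- The `k`-linear `q`-Frobenius `F_{X/k}` of a scheme over the finite field `k = 𝔽_q` acts on `Ȟ¹(X, 𝒪_X^×)` by the
`q`-th power. [cite: Hartshorne1977, IV §2 Rem. 2.4.1 and Ex. 2.4] -/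
theorem CechPic.pullback_frobeniusOver_left [Finite k] (X : SchemeOver k) (x : CechPic X.left) :
    CechPic.pullback (frobeniusOver X).left x = x ^ Nat.card k :=
  CechPic.pullback_powEndo X.left (Nat.card k) _ _ x

end OverField

/-! ## §3 `F^*L ≅ L^{⊗n}` for line bundles -/

section Modules

variable (X) (n : ℕ) (hn : n ≠ 0) (hadd : ∀ (U : X.Opens) (a b : Γ(X, U)), (a + b) ^ n = a ^ n + b ^ n)

/-- **`F^*L ≅ L^{⊗n}`**: the power endomorphism `F = powEndo X n` (e.g. the absolute Frobenius, `n = p`) pulls a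
finite locally free rank-one module `L` back to its `n`-th tensor power — both have class `[L]ⁿ` in
`Ȟ¹(X, 𝒪_X^×)` (§2, ★ `detClass_pullback`, ★ `detClass_tensorPow`) and `Pic X ↪ Ȟ¹(X, 𝒪_X^×)` (★
`nonempty_iso_iff_detClass_eq`). [cite: Hartshorne1977, IV §2 Ex. 2.4 (a) and II Ex. 6.11] -/
theorem nonempty_pullback_powEndo_iso_tensorPow {L : X.Modules} (h₁ : HasRank L 1) (hL : IsFiniteLocallyFree L) :
    Nonempty ((Scheme.Modules.pullback (powEndo X n hn hadd)).obj L ≅ tensorPow L n) := by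
  rw [nonempty_iso_iff_detClass_eq (hasRank_pullback _ h₁) (hasRank_tensorPow_one h₁ n) (hL.pullback _)
    (isFiniteLocallyFree_tensorPow hL n), detClass_pullback, detClass_tensorPow h₁ hL, CechPic.pullback_powEndo]

variable {X} in
/-- **Relative form**: if `G ≫ π = F` is a factorisation of the power endomorphism `F = powEndo X n` (e.g. the
relative Frobenius followed by the projection of the Frobenius twist), then `G^*(π^*L) ≅ L^{⊗n}` for every finite
locally free rank-one `L` on `X`. [cite: Hartshorne1977, IV §2 Rem. 2.4.1 and Ex. 2.4] -/
theorem nonempty_pullback_comp_iso_tensorPow_of_comp_eq_powEndo {Y : Scheme.{u}} (G : X ⟶ Y) (π : Y ⟶ X)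
    (hG : G ≫ π = powEndo X n hn hadd) {L : X.Modules} (h₁ : HasRank L 1) (hL : IsFiniteLocallyFree L) :
    Nonempty ((Scheme.Modules.pullback G).obj ((Scheme.Modules.pullback π).obj L) ≅ tensorPow L n) := by
  rw [nonempty_iso_iff_detClass_eq (hasRank_pullback _ (hasRank_pullback _ h₁)) (hasRank_tensorPow_one h₁ n)
    ((hL.pullback _).pullback _) (isFiniteLocallyFree_tensorPow hL n), detClass_pullback (hE := hL.pullback π),
    detClass_pullback (hE := hL), detClass_tensorPow h₁ hL, ← CechPic.pullback_comp, hG, CechPic.pullback_powEndo]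

/-- `F^{abs,*}L ≅ L^{⊗q}` for the absolute `q`-Frobenius (`q = p^m`) of a scheme over a field of exponential
characteristic `p`. [cite: Hartshorne1977, IV §2 Ex. 2.4 (a)] -/
theorem nonempty_pullback_absFrobeniusOver_iso_tensorPow {k : Type u} [Field k] (p : ℕ) [ExpChar k p] (m : ℕ)
    (X : SchemeOver k) {L : X.left.Modules} (h₁ : HasRank L 1) (hL : IsFiniteLocallyFree L) :
    Nonempty ((Scheme.Modules.pullback (absFrobeniusOver p m X)).obj L ≅ tensorPow L (p ^ m)) :=
  nonempty_pullback_powEndo_iso_tensorPow X.left (p ^ m) _ _ h₁ hL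

end Modules

end Literature.AlgebraicGeometry.Modules

/-! ## §4 Abelian varieties: `F_{A/k}^*(L^{(q)}) ≅ L^{⊗q}` -/

namespace Literature.AlgebraicGeometry.Motives

namespace AbelianVariety

open Literature.AlgebraicGeometry.Modules Literature.AlgebraicGeometry.AbelianVarieties

variable {k : Type u} [Field k] (p : ℕ) [ExpChar k p] (m : ℕ) (A : AbelianVariety k)

/-- **`F_{A/k}^*(L^{(q)}) ≅ L^{⊗q}`** for an abelian variety `A` over a field `k` of exponential characteristic `p`
(`q = p^m`): the relative Frobenius `F_{A/k} : A → A^{(q)}` pulls the Frobenius twist `L^{(q)} := pr^*L`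
(`pr : A^{(q)} → A` the projection, ★ `twistFst`) of a line bundle `L` back to `L^{⊗q}`, because
`F_{A/k} ≫ pr` is the absolute `q`-Frobenius (★ `toSchemeHom_relFrobenius_comp_twistFst`) and §3.  Shimura's
«`π⁻¹(X̃^f) = pX̃`» for modules. [cite: MumfordAV1970, §15 Thm. 1 (p. 143)] -/
theorem nonempty_pullback_relFrobenius_twist_iso_tensorPow {L : A.X.left.Modules} (h₁ : HasRank L 1)
    (hL : IsFiniteLocallyFree L) :
    Nonempty ((Scheme.Modules.pullback (Hom.toSchemeHom (A.relFrobenius p m))).obj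
      ((Scheme.Modules.pullback (twistFst p m A.X)).obj L) ≅ tensorPow L (p ^ m)) :=
  nonempty_pullback_comp_iso_tensorPow_of_comp_eq_powEndo (p ^ m) _ _ _ _
    (toSchemeHom_relFrobenius_comp_twistFst p m A) h₁ hL

end AbelianVariety

end Literature.AlgebraicGeometry.Motives

end
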